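import Summits.Ventures.PercRepro.C005Census
import Summits.Ventures.PercRepro.C026HGraph
import Summits.Ventures.PercRepro.C005Iso
import Summits.Ventures.PercRepro.C005MarkPerm

/-!
# From the kernel census to C-005 for every graph

`exists_isIso_of_pushCfg`: if the adjacency configuration of `H` pushed by the inverse relabelling
`σ'` is the configuration of the simple graph `G`, then `G` and `H` are isomorphic (`σ'` on the
vertices, a bijection of the edges chosen edge by edge; `Joins` is p5's predicate,
`C026HGraph.lean`). **`C005At_of_census`** / **`C005At_of_census_all`**: if every representative
satisfies C-005 at every `p` and the kernel loop of `C005Census.lean` passes, then every simple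
`k`-edge graph on six vertices (whose unmarked vertices have degree `≥ 3` / unconditionally)
satisfies C-005 at every `p` — C-005 transports along the isomorphism (`IsIso.c005At_of`) and
along the permutation of the marks (`C005At_perm`).
-/

namespace PercRepro

namespace MultiGraph

open Finset

variable {k : ℕ} (G : MultiGraph (Fin 6) (Fin k))

/-! ### From the configuration identity to an isomorphism -/

/-- A set adjacency bit at the pair `{x, y}` is an edge joining `x` and `y`. -/
theorem exists_joins_of_adjCfg (H : MultiGraph (Fin 6) (Fin k)) {x y : Fin 6} (hxy : x ≠ y)
    (h : H.adjCfg (pairIdx x y) = true) : ∃ e', H.Joins e' x y := by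
  rw [adjCfg_eq_true_iff] at h
  rcases pairOf_pairIdx x y hxy with hp | hp <;> rw [hp] at h <;> obtain ⟨e', he'⟩ := h <;>
    refine ⟨e', ?_⟩
  · exact he'
  · rcases he' with ⟨h1, h2⟩ | ⟨h1, h2⟩
    · exact Or.inr ⟨h1, h2⟩
    · exact Or.inl ⟨h1, h2⟩

/-- The pair of an edge of `G`, pushed by `σ'`, is set in `H` when the pushed configuration of `H`
is the configuration of `G`. -/
theorem adjCfg_push_edge {H : MultiGraph (Fin 6) (Fin k)} {σ' : Fin 6 → Fin 6}
    (h : pushCfg σ' H.adjCfg = G.adjCfg) (hG : ∀ e, G.fst e ≠ G.snd e) (e : Fin k) :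
    H.adjCfg (pairIdx (σ' (G.fst e)) (σ' (G.snd e))) = true := by
  have hq := congrFun h (G.edgePair e)
  rw [G.adjCfg_edgePair hG e] at hq
  unfold pushCfg at hq
  rcases pairOf_pairIdx (G.fst e) (G.snd e) (hG e) with hp | hp
  · rwa [edgePair, hp] at hq
  · rw [edgePair, hp] at hq
    rwa [pairIdx_comm]

/-- **The isomorphism behind a configuration identity**: if the configuration of `H` pushed by the
inverse relabelling `σ'` is the configuration of the simple graph `G`, then `G` and `H` are
isomorphic by `σ'` on the vertices (some bijection on the edges). -/
theorem exists_isIso_of_pushCfg (hG : G.IsSimple) (H : MultiGraph (Fin 6) (Fin k))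
    (σ σ' : Fin 6 → Fin 6) (h1 : ∀ i, σ' (σ i) = i) (h2 : ∀ i, σ (σ' i) = i)
    (h : pushCfg σ' H.adjCfg = G.adjCfg) :
    ∃ ψ : Fin k ≃ Fin k, G.IsIso H ⟨σ', σ, h2, h1⟩ ψ := by
  have hinj : Function.Injective σ' := fun i j hij => by rw [← h2 i, ← h2 j, hij]
  have hex : ∀ e, ∃ e', H.Joins e' (σ' (G.fst e)) (σ' (G.snd e)) := fun e =>
    H.exists_joins_of_adjCfg (fun hc => hG.1 e (hinj hc)) (adjCfg_push_edge G h hG.1 e)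
  choose ψ hψ using hex
  have hψinj : Function.Injective ψ := by
    intro e₁ e₂ he
    have j₁ := hψ e₁
    have j₂ := hψ e₂
    rw [he] at j₁
    apply hG.2
    unfold Joins at j₁ j₂
    rcases j₁ with ⟨a1, a2⟩ | ⟨a1, a2⟩ <;> rcases j₂ with ⟨b1, b2⟩ | ⟨b1, b2⟩
    · exact Or.inl ⟨hinj (a1.symm.trans b1), hinj (a2.symm.trans b2)⟩
    · exact Or.inr ⟨hinj (a1.symm.trans b1), hinj (a2.symm.trans b2)⟩
    · exact Or.inr ⟨hinj (a2.symm.trans b2), hinj (a1.symm.trans b1)⟩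
    · exact Or.inl ⟨hinj (a2.symm.trans b2), hinj (a1.symm.trans b1)⟩
  have hbij : Function.Bijective ψ := Finite.injective_iff_bijective.1 hψinj
  refine ⟨Equiv.ofBijective ψ hbij, fun e => ?_⟩
  simp only [Equiv.ofBijective_apply, Equiv.coe_fn_mk]
  exact hψ e

/-! ### The census theorem -/

/-- The marks `0, 1, 2, 3` as vertices of `Fin 6`. -/
def markVertex (i : Fin 4) : Fin 6 := ⟨i.val, by omega⟩

/-- **C-005 from a set bit of the orbit bitmap**: if the code of the simple graph `G` is in the
orbit of a representative satisfying C-005 at every `p`, then `G` satisfies C-005 at every `p`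
(the isomorphism is built from the configuration identity, C-005 transports along it and along
the permutation of the marks). -/
theorem C005At_of_testBit_orbitUnion (reps : List (MultiGraph (Fin 6) (Fin k)))
    (hreps : ∀ H ∈ reps, ∀ p : Fin k → ℝ, IsProb p → H.C005At p 0 1 2 3)
    (hG : G.IsSimple) (hbit : (orbitUnion reps).testBit (encode G.adjCfg) = true)
    (p : Fin k → ℝ) (hp : IsProb p) : G.C005At p 0 1 2 3 := by
  obtain ⟨H, hH, k, hk⟩ := exists_of_testBit_orbitUnion reps hbit
  -- the configuration identity
  have hpush : pushCfg (symOf k).2 H.adjCfg = G.adjCfg := by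
    have := congrArg (cfgOf 15) hk
    rwa [cfgOf_encode, cfgOf_encode] at this
  obtain ⟨hs1, hs2, hs3, hs4⟩ := symOf_ok k
  obtain ⟨ψ, hiso⟩ := G.exists_isIso_of_pushCfg hG H (symOf k).1 (symOf k).2 hs1 hs2 hpush
  -- C-005 for `H` at the weights `p ∘ ψ.symm`, marks permuted to `σ' 0, σ' 1, σ' 2, σ' 3`
  have hH0 : H.C005At (p ∘ ψ.symm) (markVertex 0) (markVertex 1) (markVertex 2) (markVertex 3) :=
    hreps H hH (p ∘ ψ.symm) (IsProb.comp_equiv hp ψ.symm)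
  let τ : Fin 4 → Fin 4 := fun i => ⟨((symOf k).2 (markVertex i)).val, hs4 _ (by simp [markVertex])⟩
  let τ' : Fin 4 → Fin 4 := fun i => ⟨((symOf k).1 (markVertex i)).val, hs3 _ (by simp [markVertex])⟩
  have hτ1 : ∀ i, τ' (τ i) = i := by
    intro i
    apply Fin.ext
    simp only [τ', τ, markVertex]
    have : (symOf k).1 ⟨((symOf k).2 ⟨i.val, _⟩).val, _⟩ = (symOf k).1 ((symOf k).2 ⟨i.val, by omega⟩) :=
      congrArg _ (Fin.ext rfl)
    rw [this, hs2]
  have hτ2 : ∀ i, τ (τ' i) = i := by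
    intro i
    apply Fin.ext
    simp only [τ', τ, markVertex]
    have : (symOf k).2 ⟨((symOf k).1 ⟨i.val, _⟩).val, _⟩ = (symOf k).2 ((symOf k).1 ⟨i.val, by omega⟩) :=
      congrArg _ (Fin.ext rfl)
    rw [this, hs1]
  have hperm := H.C005At_perm (p ∘ ψ.symm) markVertex τ τ' hτ1 hτ2 hH0
  have hmark : ∀ i : Fin 4, markVertex (τ i) = (symOf k).2 (markVertex i) := fun i => Fin.ext rfl
  rw [hmark, hmark, hmark, hmark] at hperm
  -- transport back to `G`
  have := hiso.c005At_of (p ∘ ψ.symm) (markVertex 0) (markVertex 1) (markVertex 2) (markVertex 3) hperm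
  have hp' : (p ∘ ψ.symm) ∘ ψ = p := by
    funext e
    simp
  rw [hp'] at this
  exact this

/-- **C-005 for every simple `k`-edge graph on six vertices whose unmarked vertices have degree
`≥ 3`, from a census**: if every representative in `reps` satisfies C-005 at every `p` (marks
`0, 1, 2, 3`) and the kernel loop certifies that every such graph is in the orbit of a
representative, then C-005 holds for every such graph at every `p`. -/
theorem C005At_of_census (reps : List (MultiGraph (Fin 6) (Fin k)))
    (hreps : ∀ H ∈ reps, ∀ p : Fin k → ℝ, IsProb p → H.C005At p 0 1 2 3)
    (hloop : censusLoop (censusCheck k (orbitUnion reps)) 32768 true = true)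
    (hG : G.IsSimple) (h4 : 3 ≤ (G.incidentEdges 4).card) (h5 : 3 ≤ (G.incidentEdges 5).card)
    (p : Fin k → ℝ) (hp : IsProb p) : G.C005At p 0 1 2 3 := by
  have hcheck := (censusLoop_spec _ _ _ hloop).2 (encode G.adjCfg) (encode_lt G.adjCfg)
  have hbit : (orbitUnion reps).testBit (encode G.adjCfg) = true := by
    unfold censusCheck at hcheck
    simp only [popMask_encode, popMask_land_vmask4, popMask_land_vmask5, G.popCfg_adjCfg hG,
      G.degCfg_adjCfg hG] at hcheck
    simpa [show ¬ (G.incidentEdges 4).card < 3 by omega,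
      show ¬ (G.incidentEdges 5).card < 3 by omega] using hcheck
  exact G.C005At_of_testBit_orbitUnion reps hreps hG hbit p hp

/-- **C-005 for EVERY simple `k`-edge graph on six vertices, from a census**: if every
representative in `reps` satisfies C-005 at every `p` and the kernel loop certifies that every
simple `k`-edge graph is in the orbit of a representative, then C-005 holds for every simple
`k`-edge graph on six vertices at every `p`. -/
theorem C005At_of_census_all (reps : List (MultiGraph (Fin 6) (Fin k)))
    (hreps : ∀ H ∈ reps, ∀ p : Fin k → ℝ, IsProb p → H.C005At p 0 1 2 3)
    (hloop : censusLoop (censusCheckAll k (orbitUnion reps)) 32768 true = true)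
    (hG : G.IsSimple) (p : Fin k → ℝ) (hp : IsProb p) : G.C005At p 0 1 2 3 := by
  have hcheck := (censusLoop_spec _ _ _ hloop).2 (encode G.adjCfg) (encode_lt G.adjCfg)
  have hbit : (orbitUnion reps).testBit (encode G.adjCfg) = true := by
    unfold censusCheckAll at hcheck
    simpa [popMask_encode, G.popCfg_adjCfg hG] using hcheck
  exact G.C005At_of_testBit_orbitUnion reps hreps hG hbit p hp

end MultiGraph

end PercRepro
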